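import Summits.QuantumFields.YangMills.Theorems.BalabanLadderIRTwistedSlabFibredSliceChart
import HarnessLib

/-!
# The slice chart in B89's currency, V: a PRODUCT window `Φ ×ˢ B` (balls in the gauge model `M` and the slice model `V`) cut out of the fibred chart
# window — the `hloc` hypothesis of lit-4's L17 `restrict_tube_eq_map_withDensity_ofReal` ∕ L18 `tendsto_laplaceMethod_orbit` VERBATIM
# (`μ.restrict (Θ' '' (Φ ×ˢ B)) = (((κ.prod ρ).restrict (Φ ×ˢ B)).withDensity (ofReal ∘ J)).map Θ'`, `κ ⊗ ρ = vol_M ⊗ vol_V`)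

HELPER toward stub **T1** `TwistedSlabAnchor` (LINE `twisted-slab-continuity`, crux `IRcof` stmt-QuantumFields-26930, census row 43;
LEAD prover ym-ir-line-tsc-p1 g3; `--supports` the crux, `--as helper`).  Sequel of `…TwistedSlabFibredSliceChart` (K17); uses lit-4 L16
`chart_restrict_of_injOn` (a chart identity restricts to injectivity sub-domains) and Mathlib's `ball_prod_same` ∕ Lusin–Souslin BY NAME.
* ★★ `exists_ball_prod_hloc` (any `L ∈ SU(N)^E`, IFT data `S`, frame `T` on `WithLp 2 (M × V)`, Haar `μ`): a radius `r > 0` such that on the product of balls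
  `Φ ×ˢ B = ball 0 r ×ˢ ball 0 r` the fibred chart map `Ψ` is injective, the density `J` is continuous, `Ψ(Φ ×ˢ B)` is measurable, and
  `μ|_{Ψ(Φ×B)} = Ψ_*((J · (vol_M.prod vol_V))|_{Φ×B})`; ★★ `exists_ball_prod_hloc_ladder` (twist-eating ladder: data discharged by K15b∕c).
NOT here (honest scope): the slice property `hslice` ∕ stabiliser `hfix` (L17 §4–§5 with K2's vacuum classification), the separation on the slice window,
the L18∕L21 call; anything uniform in `β` (M3); the cluster expansion (M4); T1-box 0∕1, T1 proper 0∕1.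

HONEST FRAMING: measure-theoretic plumbing on one box; nothing here bears on `IRcof`, `IR`, or the Yang–Mills mass gap (Clay: NOT proved); R4 =
`BalabanLadder.UV` only.  References: E. Hasenpflug, D. Rudolf, B. Sprungk (2024) §3.1 Assumption 3 (T); K. W. Breitung (1994) §2.3 Definitions 4–5.
-/

set_option autoImplicit false

noncomputable section

open scoped Matrix Matrix.Norms.L2Operator Topology ENNReal
open MeasureTheory Filter NormedSpace Set WithLp
open Literature.MathematicalPhysics.QuantumFieldTheory Literature.MathematicalPhysics.QuantumLattice
open Literature.Analysis.OperatorTheory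
open Literature.Analysis.Asymptotics

namespace Summit.QuantumFields.YangMills.Cruxes.IRcof.TwistedSlab

variable {N : ℕ} [NeZero N] {n₀ n₁ n₂ n₃ : ℕ}

section Window

variable {L : FinTorusSite n₀ n₁ n₂ n₃ × Fin 4 → Matrix (Fin N) (Fin N) ℂ}
variable {M : Type*} [NormedAddCommGroup M] [InnerProductSpace ℝ M] [FiniteDimensional ℝ M] [MeasurableSpace M] [BorelSpace M]
variable {V : Type*} [NormedAddCommGroup V] [InnerProductSpace ℝ V] [FiniteDimensional ℝ V] [MeasurableSpace V] [BorelSpace V]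
variable (hLsu : ∀ e, L e ∈ Matrix.specialUnitaryGroup (Fin N) ℂ)
  (D : (suFields N n₀ n₁ n₂ n₃ × realCoulombSlice L) ≃L[ℝ] (Fin 4 → suFields N n₀ n₁ n₂ n₃))
  (T : WithLp 2 (M × V) ≃L[ℝ] (suFields N n₀ n₁ n₂ n₃ × realCoulombSlice L))

/-- ★★ **A PRODUCT WINDOW FOR THE FIBRED CHART** (lit-4 L17∕L18's `hloc`, verbatim): for `L ∈ SU(N)^E` with IFT data `S`, every frame `T` on an
`L²`-product model `M × V` and every Haar measure `μ` on `SU(N)^E` there is `r > 0` such that on `ball 0 r ×ˢ ball 0 r` the fibred chart map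
`Ψ(p, y) = e^{φ} • (e^{y}·L)` (`(φ, y) = T(p, y)`) is injective, the density is continuous, the image is measurable and
`μ|_{Ψ(Φ ×ˢ B)} = Ψ_*((J · (vol_M ⊗ vol_V))|_{Φ ×ˢ B})`. [cite: HasenpflugRudolfSprungk2024, §3.1 Assumption 3 (T)] [cite: Breitung1994, §2.3 Definitions 4–5 pp. 14–15] -/
theorem exists_ball_prod_hloc {S : Set (suFields N n₀ n₁ n₂ n₃ × realCoulombSlice L)} (hSo : IsOpen S)
    (hS0 : (0 : suFields N n₀ n₁ n₂ n₃ × realCoulombSlice L) ∈ S) (hSinj : InjOn (slicePsiSu L) S)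
    (μ : Measure (FinTorusSite n₀ n₁ n₂ n₃ × Fin 4 → Matrix.specialUnitaryGroup (Fin N) ℂ)) [μ.IsHaarMeasure] :
    ∃ r : ℝ, 0 < r ∧ InjOn (fibredChartMap hLsu T) (Metric.ball (0 : M) r ×ˢ Metric.ball (0 : V) r) ∧
      ContinuousOn (fibredChartDensity hLsu D T μ) (Metric.ball (0 : M) r ×ˢ Metric.ball (0 : V) r) ∧
      MeasurableSet (fibredChartMap hLsu T '' (Metric.ball (0 : M) r ×ˢ Metric.ball (0 : V) r)) ∧
      μ.restrict (fibredChartMap hLsu T '' (Metric.ball (0 : M) r ×ˢ Metric.ball (0 : V) r)) =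
        ((((volume : Measure M).prod (volume : Measure V)).restrict (Metric.ball (0 : M) r ×ˢ Metric.ball (0 : V) r)).withDensity
          fun z => ENNReal.ofReal (fibredChartDensity hLsu D T μ z)).map (fibredChartMap hLsu T) := by
  obtain ⟨W, hWo, hW0, hinj, hcont, _, hchart⟩ := haar_restrict_fibredChartMap_image_eq_map_withDensity hLsu D T hSo hS0 hSinj μ
  obtain ⟨r, hr, hball⟩ := Metric.mem_nhds_iff.1 (hWo.mem_nhds hW0)
  have hsub : Metric.ball (0 : M) r ×ˢ Metric.ball (0 : V) r ⊆ W := by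
    rw [ball_prod_same]; exact hball
  have hm : MeasurableSet (Metric.ball (0 : M) r ×ˢ Metric.ball (0 : V) r) := (Metric.isOpen_ball.prod Metric.isOpen_ball).measurableSet
  have himg : MeasurableSet (fibredChartMap hLsu T '' (Metric.ball (0 : M) r ×ˢ Metric.ball (0 : V) r)) :=
    hm.image_of_continuousOn_injOn (continuous_fibredChartMap hLsu T).continuousOn (hinj.mono hsub)
  refine ⟨r, hr, hinj.mono hsub, hcont.mono hsub, himg, ?_⟩
  have h := chart_restrict_of_injOn (κ := (volume : Measure (M × V))) (continuous_fibredChartMap hLsu T).measurable hinj hsub himg hchart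
  rw [Measure.volume_eq_prod] at h
  exact h

end Window

section Ladder

variable {m n₂' n₃' : ℕ} {A B : Matrix (Fin N) (Fin N) ℂ} {ω : ℂ} {Γ₂ Γ₃ : Matrix (Fin N) (Fin N) ℂ}
variable {M : Type*} [NormedAddCommGroup M] [InnerProductSpace ℝ M] [FiniteDimensional ℝ M] [MeasurableSpace M] [BorelSpace M]
variable {V : Type*} [NormedAddCommGroup V] [InnerProductSpace ℝ V] [FiniteDimensional ℝ V] [MeasurableSpace V] [BorelSpace V]

/-- ★★ **THE PRODUCT WINDOW AT THE TWIST-EATING LADDER** (`D = DΨ̂(0)`, IFT data from K15b∕c). [cite: HasenpflugRudolfSprungk2024, §3.1 Assumption 3 (T)] -/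
theorem exists_ball_prod_hloc_ladder (hAu : A ∈ Matrix.unitaryGroup (Fin N) ℂ) (hBu : B ∈ Matrix.unitaryGroup (Fin N) ℂ) (hω : IsPrimitiveRoot ω N)
    (hAB : A * B = ω • (B * A)) (hNm : 2 ≤ N * (m + 1))
    (hL : ∀ e, ladderField (n₀ := m + 1) (n₁ := m + 1) (n₂ := n₂') (n₃ := n₃') ![A, B, Γ₂, Γ₃] e ∈ Matrix.specialUnitaryGroup (Fin N) ℂ)
    (T : WithLp 2 (M × V) ≃L[ℝ] (suFields N (m + 1) (m + 1) n₂' n₃' ×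
      realCoulombSlice (ladderField (n₀ := m + 1) (n₁ := m + 1) (n₂ := n₂') (n₃ := n₃') ![A, B, Γ₂, Γ₃])))
    (μ : Measure (FinTorusSite (m + 1) (m + 1) n₂' n₃' × Fin 4 → Matrix.specialUnitaryGroup (Fin N) ℂ)) [μ.IsHaarMeasure] :
    ∃ r : ℝ, 0 < r ∧ InjOn (fibredChartMap hL T) (Metric.ball (0 : M) r ×ˢ Metric.ball (0 : V) r) ∧
      ContinuousOn (fibredChartDensity hL (slicePsiSuDeriv hAu hBu hω hAB hNm hL) T μ) (Metric.ball (0 : M) r ×ˢ Metric.ball (0 : V) r) ∧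
      MeasurableSet (fibredChartMap hL T '' (Metric.ball (0 : M) r ×ˢ Metric.ball (0 : V) r)) ∧
      μ.restrict (fibredChartMap hL T '' (Metric.ball (0 : M) r ×ˢ Metric.ball (0 : V) r)) =
        ((((volume : Measure M).prod (volume : Measure V)).restrict (Metric.ball (0 : M) r ×ˢ Metric.ball (0 : V) r)).withDensity
          fun z => ENNReal.ofReal (fibredChartDensity hL (slicePsiSuDeriv hAu hBu hω hAB hNm hL) T μ z)).map (fibredChartMap hL T) :=
  exists_ball_prod_hloc hL (slicePsiSuDeriv hAu hBu hω hAB hNm hL) T (isOpen_sliceChart_source hAu hBu hω hAB hNm hL)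
    (zero_mem_sliceChart_source hAu hBu hω hAB hNm hL) (injOn_slicePsiSu_sliceChart_source hAu hBu hω hAB hNm hL) μ

end Ladder

end Summit.QuantumFields.YangMills.Cruxes.IRcof.TwistedSlab

end
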